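import Summits.CriticalPhenomena.CardyFormulaZ2.Theorems.CardyUniqueLimitCardyRigidityDefs
import Summits.CriticalPhenomena.CardyFormulaZ2.Theorems.DyadicBetaRigidityDyadicBetaSufficesBeta
import HarnessLib

/-!
# Pinning `a = 2/3` from an affine relation between beta laws (line `crossing_martingale`)

Sub-problem `CriticalPhenomena/CardyFormulaZ2`; crux
`Summit.CriticalPhenomena.CardyFormulaZ2.Theses.CardyUniqueLimit.CardyRigidity`
(stmt-CriticalPhenomena-0746), line `crossing_martingale` (definitions module
`Theorems/CardyUniqueLimitCardyRigidityDefs.lean`).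

Glue between STUB B (`stub_betaPinning`: an `I_a`-crossing-martingale regular driver has
`a = 2/3`) and the deterministic half C2 of STUB C (`affineBeta_of_farField`, file `…AffineBeta`:
`HasFarFieldIdentities f κ ⇒ f = A·I_{2/3} + B` on `(0,1)`): since `I_a` is continuous on `(0,1)`
(`DyadicLattice.continuousOn_betaLaw`), the far-field identities for the kernel `I_a` give
`I_a = A·I_{2/3} + B` on `(0,1)`, and THIS file concludes `a = 2/3` (`betaLaw_affine_pin`,
registered glue sub-goal).  Hence ONE probabilistic far-field theorem
(C1: `IsRegularDriver μ W 𝓕 → IsCrossingMartingaleFamily f μ W 𝓕 → HasFarFieldIdentities f (E W₁²)`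
for continuous `f`) closes both STUB B and STUB C.

Proof: differentiate the affine relation on `(0,1)` (`BetaLawPin.hasDerivAt_betaLaw`, from the
tree's integrability of the beta kernel `DyadicLattice.intervalIntegrable_symmBetaKernel_of_mem` and
the fundamental theorem of calculus): `(η(1-η))^{-a}/B_a = A (η(1-η))^{-2/3}/B_{2/3}`; comparing
`η = 1/2` and `η = 1/4` gives `(3/4)^{-a} = (3/4)^{-2/3}`, so `a = 2/3`.

References: Cardy (1992), eq. (8).
-/

noncomputable section

open MeasureTheory Filter Set Topology
open scoped NNReal
open Literature.Probability.RandomPlanarGeometry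
open Summit.CriticalPhenomena.CardyFormulaZ2.Theorems.DyadicLattice

namespace Summit.CriticalPhenomena.CardyFormulaZ2.Cruxes.CardyRigidity.CrossingMartingale

namespace BetaLawPin

/-- The beta kernel `(s(1-s))^{-a}` is continuous on `(0,1)`. [folklore] -/
theorem continuousOn_symmBetaKernel (a : ℝ) :
    ContinuousOn (fun s : ℝ ↦ (s * (1 - s)) ^ (-a)) (Ioo 0 1) := by
  refine ContinuousOn.rpow_const (continuousOn_id.mul (continuousOn_const.sub continuousOn_id))
    fun s hs ↦ Or.inl ?_
  exact (mul_pos hs.1 (by linarith [hs.2])).ne'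

/-- **Derivative of the beta law** on `(0,1)` for `a < 1`:
`I_a'(η) = (η(1-η))^{-a} / ∫₀¹ (s(1-s))^{-a} ds`. [cite: Cardy1992, eq. (8)] -/
theorem hasDerivAt_betaLaw {a : ℝ} (ha : a < 1) {η : ℝ} (hη : η ∈ Ioo (0 : ℝ) 1) :
    HasDerivAt (betaLaw a)
      ((η * (1 - η)) ^ (-a) / ∫ s in (0 : ℝ)..1, (s * (1 - s)) ^ (-a)) η := by
  have hint := intervalIntegrable_symmBetaKernel_of_mem ha ⟨le_rfl, zero_le_one⟩
    ⟨hη.1.le, hη.2.le⟩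
  have hmeas : StronglyMeasurableAtFilter (fun s : ℝ ↦ (s * (1 - s)) ^ (-a)) (𝓝 η) volume :=
    (continuousOn_symmBetaKernel a).stronglyMeasurableAtFilter isOpen_Ioo η hη
  have hcont : ContinuousAt (fun s : ℝ ↦ (s * (1 - s)) ^ (-a)) η :=
    (continuousOn_symmBetaKernel a).continuousAt (Ioo_mem_nhds hη.1 hη.2)
  have h := (intervalIntegral.integral_hasDerivAt_right hint hmeas hcont).div_const
    (∫ s in (0 : ℝ)..1, (s * (1 - s)) ^ (-a))
  exact h

/-- The derivative identity forced by an affine relation `I_a = A·I_{2/3} + B` on `(0,1)`.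
[folklore] -/
theorem kernel_eq_of_affine {a A B : ℝ} (ha : a < 1)
    (h : EqOn (betaLaw a) (fun η ↦ A * betaLaw (2 / 3) η + B) (Ioo 0 1)) {η : ℝ}
    (hη : η ∈ Ioo (0 : ℝ) 1) :
    (η * (1 - η)) ^ (-a) / (∫ s in (0 : ℝ)..1, (s * (1 - s)) ^ (-a)) =
      A * ((η * (1 - η)) ^ (-(2 / 3 : ℝ)) / ∫ s in (0 : ℝ)..1, (s * (1 - s)) ^ (-(2 / 3 : ℝ))) := by
  have h23 : (2 / 3 : ℝ) < 1 := by norm_num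
  have h1 := hasDerivAt_betaLaw ha hη
  have h2 : HasDerivAt (fun η ↦ A * betaLaw (2 / 3) η + B)
      (A * ((η * (1 - η)) ^ (-(2 / 3 : ℝ)) / ∫ s in (0 : ℝ)..1, (s * (1 - s)) ^ (-(2 / 3 : ℝ))))
      η := by
    have := ((hasDerivAt_betaLaw h23 hη).const_mul A).add_const B
    simpa using this
  have h3 : HasDerivAt (betaLaw a)
      (A * ((η * (1 - η)) ^ (-(2 / 3 : ℝ)) / ∫ s in (0 : ℝ)..1, (s * (1 - s)) ^ (-(2 / 3 : ℝ))))
      η :=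
    h2.congr_of_eventuallyEq (h.eventuallyEq_of_mem (isOpen_Ioo.mem_nhds hη))
  exact h1.unique h3

/-- **Pinning the exponent.** If `I_a = A·I_{2/3} + B` on `(0,1)` for some `a < 1`, then
`a = 2/3`: compare the forced kernel identity at `η = 1/2` and `η = 1/4`
(`(1/4)^{-a}/(3/16)^{-a} = (1/4)^{-2/3}/(3/16)^{-2/3}`, i.e. `(4/3)^a = (4/3)^{2/3}`).
[cite: Cardy1992, eq. (8)] -/
theorem eq_two_thirds_of_affine {a A B : ℝ} (ha : a < 1)
    (h : EqOn (betaLaw a) (fun η ↦ A * betaLaw (2 / 3) η + B) (Ioo 0 1)) : a = 2 / 3 := by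
  have h23 : (2 / 3 : ℝ) < 1 := by norm_num
  set βa : ℝ := ∫ s in (0 : ℝ)..1, (s * (1 - s)) ^ (-a) with hβa
  set β' : ℝ := ∫ s in (0 : ℝ)..1, (s * (1 - s)) ^ (-(2 / 3 : ℝ)) with hβ'
  have hβa0 : 0 < βa := beta_pos ha
  have hβ'0 : 0 < β' := beta_pos h23
  have e1 := kernel_eq_of_affine ha h (η := 1 / 2) ⟨by norm_num, by norm_num⟩
  have e2 := kernel_eq_of_affine ha h (η := 1 / 4) ⟨by norm_num, by norm_num⟩
  rw [← hβa, ← hβ'] at e1 e2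
  have hx : (1 / 2 : ℝ) * (1 - 1 / 2) = 1 / 4 := by norm_num
  have hy : (1 / 4 : ℝ) * (1 - 1 / 4) = 3 / 16 := by norm_num
  rw [hx] at e1
  rw [hy] at e2
  -- positivity of the kernel values
  have p1 : 0 < (1 / 4 : ℝ) ^ (-a) := Real.rpow_pos_of_pos (by norm_num) _
  have p2 : 0 < (3 / 16 : ℝ) ^ (-a) := Real.rpow_pos_of_pos (by norm_num) _
  have q1 : 0 < (1 / 4 : ℝ) ^ (-(2 / 3 : ℝ)) := Real.rpow_pos_of_pos (by norm_num) _
  have q2 : 0 < (3 / 16 : ℝ) ^ (-(2 / 3 : ℝ)) := Real.rpow_pos_of_pos (by norm_num) _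
  -- cross-multiplied: x₁ y₂ = x₂ y₁ for xᵢ = kernels of `a`, yᵢ = kernels of `2/3`
  have key : (1 / 4 : ℝ) ^ (-a) * (3 / 16 : ℝ) ^ (-(2 / 3 : ℝ)) =
      (3 / 16 : ℝ) ^ (-a) * (1 / 4 : ℝ) ^ (-(2 / 3 : ℝ)) := by
    have hA : A = (1 / 4 : ℝ) ^ (-a) / βa * β' / (1 / 4 : ℝ) ^ (-(2 / 3 : ℝ)) := by
      rw [e1]; field_simp
    rw [hA] at e2
    field_simp at e2
    nlinarith [e2, p1, p2, q1, q2, hβa0, hβ'0]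
  -- hence `(4/3)^{-a} = (4/3)^{-2/3}` … via the ratio `(3/16)/(1/4) = 3/4`
  have r1 : (3 / 16 : ℝ) ^ (-a) = (3 / 4 : ℝ) ^ (-a) * (1 / 4 : ℝ) ^ (-a) := by
    rw [← Real.mul_rpow (by norm_num) (by norm_num)]; norm_num
  have r2 : (3 / 16 : ℝ) ^ (-(2 / 3 : ℝ)) = (3 / 4 : ℝ) ^ (-(2 / 3 : ℝ)) * (1 / 4 : ℝ) ^ (-(2 / 3 : ℝ)) := by
    rw [← Real.mul_rpow (by norm_num) (by norm_num)]; norm_num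
  rw [r1, r2] at key
  have key2 : (3 / 4 : ℝ) ^ (-(2 / 3 : ℝ)) = (3 / 4 : ℝ) ^ (-a) := by
    have hne : (1 / 4 : ℝ) ^ (-a) * (1 / 4 : ℝ) ^ (-(2 / 3 : ℝ)) ≠ 0 := (mul_pos p1 q1).ne'
    have : ((3 / 4 : ℝ) ^ (-(2 / 3 : ℝ)) - (3 / 4 : ℝ) ^ (-a)) *
        ((1 / 4 : ℝ) ^ (-a) * (1 / 4 : ℝ) ^ (-(2 / 3 : ℝ))) = 0 := by linear_combination key
    rcases mul_eq_zero.1 this with h0 | h0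
    · linarith
    · exact absurd h0 hne
  -- injectivity of `p ↦ (3/4)^p`
  have hb0 : (0 : ℝ) < 3 / 4 := by norm_num
  have hb1 : (3 / 4 : ℝ) < 1 := by norm_num
  have hle1 : -(2 / 3 : ℝ) ≤ -a := by
    rw [← Real.rpow_le_rpow_left_iff_of_base_lt_one hb0 hb1]; exact key2.symm.le
  have hle2 : -a ≤ -(2 / 3 : ℝ) := by
    rw [← Real.rpow_le_rpow_left_iff_of_base_lt_one hb0 hb1]; exact key2.le
  linarith

end BetaLawPin

/-- **Beta pinning from the affine form** (glue of stmt-CriticalPhenomena-0746, line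
`crossing_martingale`: reduces STUB B `stub_betaPinning` to STUB C's far-field half C1 through
`affineBeta_of_farField`): if `I_a = A·I_{2/3} + B` on `(0,1)` with `a ∈ (0,1)`, then `a = 2/3`.
[cite: Cardy1992, eq. (8)] -/
theorem betaLaw_affine_pin : ∀ {a A B : ℝ}, a ∈ Ioo (0 : ℝ) 1 → EqOn (betaLaw a) (fun η ↦ A * betaLaw (2 / 3) η + B) (Ioo 0 1) → a = 2 / 3 :=
  fun ha h ↦ BetaLawPin.eq_two_thirds_of_affine ha.2 h

end Summit.CriticalPhenomena.CardyFormulaZ2.Cruxes.CardyRigidity.CrossingMartingale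

end
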